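import Literature.Combinatorics.Additive.BalogSzemerediGowers
import Mathlib.Algebra.Order.Chebyshev
import HarnessLib

/-!
# The Balog–Szemerédi–Gowers theorem — proof of `balogSzemerediGowers`

Topic `Literature/Combinatorics/Additive`; proof file behind the named fact
`Literature.Combinatorics.Additive.balogSzemerediGowers` (`BalogSzemerediGowers.lean`):
T. Tao, V. Vu, *Additive Combinatorics*, CUP 2006, Theorem 2.29 (the two-set / graph form), with
the constants as printed (`|A'| ≥ |A|/(4√2 K)`, `|B'| ≥ |B|/(4K)`,
`|A' + B'| ≤ 2¹² K⁵ (K')³ |A|^{1/2}|B|^{1/2}`). (The sibling `BalogSzemerediGowersProofs.lean`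
proves the single-set energy form `Zhao2023_thm7136` by Gowers' argument; the two files are
independent.)

We follow the graph-theoretic proof of Tao–Vu §6.4 step by step; the bipartite
graph is kept as a relation `G ⊆ A ×ˢ B` between two arbitrary types `α`, `β`, so the
disjointness trick `Z ↦ Z × ℤ` at the start of the printed proof of Theorem 2.29 is not needed.
Throughout, `{x ∈ A | (x, b) ∈ G}` and `{y ∈ B | (a, y) ∈ G}` are neighbourhoods,
`#{y ∈ B | (a, y) ∈ G ∧ (a', y) ∈ G}` counts the paths of length two `a — y — a'`, and
`#{q ∈ A ×ˢ B | (a, q.2) ∈ G ∧ (q.1, q.2) ∈ G ∧ (q.1, b) ∈ G}` counts the paths of length three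
`a — b' — a' — b` (with `q = (a', b')`).

* `BalogSzemerediGowersProof.paths_two` — **Lemma 6.19** (paths of length two): if
  `|G| ≥ |A||B|/K` then some neighbourhood `A' = N(b)` has `|A'| ≥ |A|/(√2 K)` and at most
  `ε|A'|²` pairs of `A'` are joined by fewer than `τ ≤ ε|B|/(2K²)` paths of length two
  (Cauchy–Schwarz `∑_b deg(b)² ≥ |G|²/|B|`, the weight `1 − ε⁻¹·𝟙[bad]`, pigeonhole in `b`).
* `BalogSzemerediGowersProof.paths_three` — **Corollary 6.20** (paths of length three), assembled
  from `prune` (drop the vertices of degree `< |B|/2K`, keeping `≥ |A||B|/2K` edges), `paths_two`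
  applied with `K̃ = 2K|Ã|/|A|`, `ε = 1/(16K)` and threshold `|B|/(128K³) ≤ L²|B|/(128K³)`
  (`threshold_le`), `half_good` (the `a` in `≤ |Ã'|/8K` bad pairs are at least half of `Ã'`),
  `popular` (the `b` with `≥ |Ã'|/4K` neighbours in `Ã'` number `≥ |B|/4K`) and `count_paths`
  (`≥ |Ã'|/8K` good neighbours of `b`, each giving `≥ |B|/(128K³)` paths), with the constant
  `16√2 · 128 = 2¹¹√2 ≤ 2¹²` (`const_bound`). (The printed proof twice writes `128K²` where
  `128K³` is meant; the final product is as printed.)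
* `balogSzemerediGowers_holds` — **Theorem 2.29**: the identity
  `a + b = (a + b') − (a' + b') + (a' + b)` maps the paths of length three from `a` to `b`
  injectively into `{(x, y, z) ∈ (A +_G B)³ : x − y + z = a + b}`; these fibres are disjoint for
  distinct sums, so `|A' + B'| · |A||B|/(2¹²K⁵) ≤ |A +_G B|³ ≤ (K')³ (|A||B|)^{3/2}`.

## References
* [TaoVu2006] T. Tao, V. Vu, *Additive Combinatorics*, Cambridge Studies in Advanced
  Mathematics 105, CUP 2006, doi:10.1017/cbo9780511755149 — §2.5, Theorem 2.29 (statement) and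
  §6.4, Lemma 6.19, Corollary 6.20 and the proof of Theorem 2.29.
-/

namespace Literature.Combinatorics.Additive

open Finset
open scoped Pointwise

namespace BalogSzemerediGowersProof

variable {α β : Type*} [DecidableEq α] [DecidableEq β]

/-- `|E| = ∑_{b ∈ B} |N(b)|` (the first combinatorial identity in the proof of Lemma 6.19).
[cite: TaoVu2006, §6.4, proof of Lemma 6.19] -/
lemma card_eq_sum_deg_right {A : Finset α} {B : Finset β} {G : Finset (α × β)}
    (hG : G ⊆ A ×ˢ B) : (G.card : ℝ) = ∑ b ∈ B, (#{x ∈ A | (x, b) ∈ G} : ℝ) := by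
  have hGf : G = (A ×ˢ B).filter (fun p => p ∈ G) := by
    ext p
    simp only [mem_filter]
    exact ⟨fun hp => ⟨hG hp, hp⟩, fun hp => hp.2⟩
  have h : G.card = ∑ b ∈ B, #{x ∈ A | (x, b) ∈ G} := by
    conv_lhs => rw [hGf]
    rw [card_filter, sum_product_right]
    refine sum_congr rfl fun b _ => ?_
    rw [card_filter]
  exact_mod_cast h

/-- `|E| = ∑_{a ∈ A} |N(a)|`.
[cite: TaoVu2006, §6.4, proof of Lemma 6.19] -/
lemma card_eq_sum_deg_left {A : Finset α} {B : Finset β} {G : Finset (α × β)}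
    (hG : G ⊆ A ×ˢ B) : (G.card : ℝ) = ∑ a ∈ A, (#{y ∈ B | (a, y) ∈ G} : ℝ) := by
  have hGf : G = (A ×ˢ B).filter (fun p => p ∈ G) := by
    ext p
    simp only [mem_filter]
    exact ⟨fun hp => ⟨hG hp, hp⟩, fun hp => hp.2⟩
  have h : G.card = ∑ a ∈ A, #{y ∈ B | (a, y) ∈ G} := by
    conv_lhs => rw [hGf]
    rw [card_filter, sum_product]
    refine sum_congr rfl fun a _ => ?_
    rw [card_filter]
  exact_mod_cast h

/-- The number of paths of length two `a — y — a'` as a sum of products of indicators.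
[cite: TaoVu2006, §6.4, proof of Lemma 6.19] -/
lemma paths₂_eq_sum (B : Finset β) (G : Finset (α × β)) (a a' : α) :
    (#{y ∈ B | (a, y) ∈ G ∧ (a', y) ∈ G} : ℝ) =
      ∑ b ∈ B, (if (a, b) ∈ G then (1 : ℝ) else 0) * (if (a', b) ∈ G then (1 : ℝ) else 0) := by
  rw [card_filter]
  push_cast
  refine sum_congr rfl fun b _ => ?_
  by_cases h1 : (a, b) ∈ G <;> by_cases h2 : (a', b) ∈ G <;> simp [h1, h2]

/-- Paths of length two are monotone in the edge set. [folklore] -/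
lemma paths₂_mono (B : Finset β) {G G' : Finset (α × β)} (h : G' ⊆ G) (a a' : α) :
    #{y ∈ B | (a, y) ∈ G' ∧ (a', y) ∈ G'} ≤ #{y ∈ B | (a, y) ∈ G ∧ (a', y) ∈ G} := by
  exact card_le_card (fun b hb => by
    rw [mem_filter] at hb ⊢
    exact ⟨hb.1, h hb.2.1, h hb.2.2⟩)

/-- `∑_{b ∈ B} |N(b)|² = ∑_{a, a' ∈ A} |N(a) ∩ N(a')|` (the second combinatorial identity in the
proof of Lemma 6.19). [cite: TaoVu2006, §6.4, proof of Lemma 6.19] -/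
lemma sum_deg_sq (A : Finset α) (B : Finset β) (G : Finset (α × β)) :
    ∑ b ∈ B, (#{x ∈ A | (x, b) ∈ G} : ℝ) ^ 2
      = ∑ a ∈ A, ∑ a' ∈ A, (#{y ∈ B | (a, y) ∈ G ∧ (a', y) ∈ G} : ℝ) := by
  have hdeg : ∀ b, (#{x ∈ A | (x, b) ∈ G} : ℝ) = ∑ a ∈ A, (if (a, b) ∈ G then (1 : ℝ) else 0) := by
    intro b
    rw [card_filter]
    push_cast
    rfl
  simp_rw [paths₂_eq_sum, hdeg, sq, sum_mul_sum]
  rw [sum_comm]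
  refine sum_congr rfl fun a _ => ?_
  rw [sum_comm]

/-- Sums over a neighbourhood are indicator-weighted sums over `A`. [folklore] -/
lemma sum_nbhd (A : Finset α) (G : Finset (α × β)) (b : β) (f : α → ℝ) :
    ∑ a ∈ {x ∈ A | (x, b) ∈ G}, f a = ∑ a ∈ A, (if (a, b) ∈ G then (1 : ℝ) else 0) * f a := by
  simp only [sum_filter, boole_mul]

/-- Paths of length three from `a` to `b` through a set `T` of neighbours `a'` of `b` number at
least `∑_{a' ∈ T} |N(a) ∩ N(a')|`. [cite: TaoVu2006, §6.4, proof of Corollary 6.20 (last step)] -/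
lemma sum_paths₂_le_paths₃ {A : Finset α} {B : Finset β} {G : Finset (α × β)} {T : Finset α}
    (hT : T ⊆ A) {a : α} {b : β} (hTb : ∀ a' ∈ T, (a', b) ∈ G) :
    ∑ a' ∈ T, #{y ∈ B | (a, y) ∈ G ∧ (a', y) ∈ G}
      ≤ #{q ∈ A ×ˢ B | (a, q.2) ∈ G ∧ (q.1, q.2) ∈ G ∧ (q.1, b) ∈ G} := by
  rw [card_filter, sum_product]
  calc ∑ a' ∈ T, #{y ∈ B | (a, y) ∈ G ∧ (a', y) ∈ G}
      = ∑ a' ∈ T, ∑ b' ∈ B,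
          (if (a, (a', b').2) ∈ G ∧ ((a', b').1, (a', b').2) ∈ G ∧ ((a', b').1, b) ∈ G
            then 1 else 0) := by
        refine sum_congr rfl fun a' ha' => ?_
        rw [card_filter]
        refine sum_congr rfl fun b' _ => ?_
        simp [hTb a' ha']
    _ ≤ _ := sum_le_sum_of_subset_of_nonneg hT fun _ _ _ => Nat.zero_le _

/-- **Paths of length two** (Tao–Vu, Lemma 6.19, in the quantitative form used below): if
`G ⊆ A ×ˢ B` has at least `|A||B|/K` edges then some neighbourhood `A' = N(b)` has
`|A'| ≥ |A|/(√2 K)` and at most `ε|A'|²` of the pairs `(a, a') ∈ A' × A'` are joined by fewer than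
`τ ≤ ε|B|/(2K²)` paths of length two. [cite: TaoVu2006, Lemma 6.19] -/
lemma paths_two (A : Finset α) (B : Finset β) (G : Finset (α × β)) {K ε τ : ℝ} (hK : 0 < K)
    (hε : 0 < ε) (hτ0 : 0 ≤ τ) (hτ : τ ≤ ε * B.card / (2 * K ^ 2)) (hG : G ⊆ A ×ˢ B)
    (hB : B.Nonempty) (hE : (A.card : ℝ) * B.card / K ≤ G.card) :
    ∃ A' ⊆ A, (A.card : ℝ) / (Real.sqrt 2 * K) ≤ A'.card ∧
      ∑ a ∈ A', (#{a' ∈ A' | (#{y ∈ B | (a, y) ∈ G ∧ (a', y) ∈ G} : ℝ) < τ} : ℝ)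
        ≤ ε * (A'.card : ℝ) ^ 2 := by
  obtain ⟨w, hw⟩ : ∃ w : α → α → ℝ,
      ∀ a a', w a a' = 1 - ε⁻¹ * (if (#{y ∈ B | (a, y) ∈ G ∧ (a', y) ∈ G} : ℝ) < τ then 1 else 0) :=
    ⟨_, fun _ _ => rfl⟩
  obtain ⟨S, hS⟩ : ∃ S : β → ℝ,
      ∀ b, S b = ∑ a ∈ {x ∈ A | (x, b) ∈ G}, ∑ a' ∈ {x ∈ A | (x, b) ∈ G}, w a a' :=
    ⟨_, fun _ => rfl⟩
  have hBpos : (0 : ℝ) < B.card := by exact_mod_cast hB.card_pos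
  have hεi : (0 : ℝ) < ε⁻¹ := inv_pos.mpr hε
  -- Step 1: `∑_b S b = ∑_{a,a'} w(a,a') |N(a) ∩ N(a')|` (double counting).
  have h1 : ∑ b ∈ B, S b = ∑ a ∈ A, ∑ a' ∈ A, w a a' * #{y ∈ B | (a, y) ∈ G ∧ (a', y) ∈ G} := by
    simp only [hS, sum_nbhd, mul_sum]
    rw [sum_comm]
    refine sum_congr rfl fun a _ => ?_
    rw [sum_comm]
    refine sum_congr rfl fun a' _ => ?_
    rw [paths₂_eq_sum, mul_sum]
    refine sum_congr rfl fun b _ => ?_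
    ring
  -- Step 2: the lower bound `∑_b S b ≥ |A|²|B|/(2K²)` (Cauchy–Schwarz).
  have h2 : (A.card : ℝ) ^ 2 * B.card / (2 * K ^ 2) ≤ ∑ b ∈ B, S b := by
    rw [h1]
    have hpt : ∀ a a', (#{y ∈ B | (a, y) ∈ G ∧ (a', y) ∈ G} : ℝ) - ε⁻¹ * τ
        ≤ w a a' * #{y ∈ B | (a, y) ∈ G ∧ (a', y) ∈ G} := by
      intro a a'
      rw [hw]
      have hc : (0 : ℝ) ≤ #{y ∈ B | (a, y) ∈ G ∧ (a', y) ∈ G} := Nat.cast_nonneg _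
      split_ifs with h
      · nlinarith [mul_le_mul_of_nonneg_left h.le hεi.le]
      · nlinarith [mul_nonneg hεi.le hτ0]
    have hsum : ∑ a ∈ A, ∑ a' ∈ A, ((#{y ∈ B | (a, y) ∈ G ∧ (a', y) ∈ G} : ℝ) - ε⁻¹ * τ)
        ≤ ∑ a ∈ A, ∑ a' ∈ A, w a a' * #{y ∈ B | (a, y) ∈ G ∧ (a', y) ∈ G} :=
      sum_le_sum fun a _ => sum_le_sum fun a' _ => hpt a a'
    have hsum2 : ∑ a ∈ A, ∑ a' ∈ A, ((#{y ∈ B | (a, y) ∈ G ∧ (a', y) ∈ G} : ℝ) - ε⁻¹ * τ)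
        = ∑ b ∈ B, (#{x ∈ A | (x, b) ∈ G} : ℝ) ^ 2 - (A.card : ℝ) ^ 2 * (ε⁻¹ * τ) := by
      simp only [sum_sub_distrib, sum_const, sum_deg_sq]
      ring
    have hCS : (∑ b ∈ B, (#{x ∈ A | (x, b) ∈ G} : ℝ)) ^ 2
        ≤ B.card * ∑ b ∈ B, (#{x ∈ A | (x, b) ∈ G} : ℝ) ^ 2 := sq_sum_le_card_mul_sum_sq
    rw [← card_eq_sum_deg_right hG] at hCS
    have hG2 : ((A.card : ℝ) * B.card / K) ^ 2 ≤ (G.card : ℝ) ^ 2 :=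
      pow_le_pow_left₀ (by positivity) hE 2
    have hd2 : (A.card : ℝ) ^ 2 * B.card / K ^ 2 ≤ ∑ b ∈ B, (#{x ∈ A | (x, b) ∈ G} : ℝ) ^ 2 := by
      have h := hG2.trans hCS
      have e : ((A.card : ℝ) * B.card / K) ^ 2
          = B.card * ((A.card : ℝ) ^ 2 * B.card / K ^ 2) := by ring
      rw [e] at h
      exact le_of_mul_le_mul_left h hBpos
    have hετ : (A.card : ℝ) ^ 2 * (ε⁻¹ * τ) ≤ (A.card : ℝ) ^ 2 * (B.card / (2 * K ^ 2)) := by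
      refine mul_le_mul_of_nonneg_left ?_ (by positivity)
      calc ε⁻¹ * τ ≤ ε⁻¹ * (ε * B.card / (2 * K ^ 2)) := mul_le_mul_of_nonneg_left hτ hεi.le
        _ = B.card / (2 * K ^ 2) := by field_simp
    calc (A.card : ℝ) ^ 2 * B.card / (2 * K ^ 2)
        = (A.card : ℝ) ^ 2 * B.card / K ^ 2 - (A.card : ℝ) ^ 2 * (B.card / (2 * K ^ 2)) := by
          ring
      _ ≤ ∑ b ∈ B, (#{x ∈ A | (x, b) ∈ G} : ℝ) ^ 2 - (A.card : ℝ) ^ 2 * (ε⁻¹ * τ) := by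
          linarith [hd2]
      _ = _ := hsum2.symm
      _ ≤ _ := hsum
  -- Step 3: pigeonhole a vertex `b`.
  obtain ⟨b, -, hSb⟩ : ∃ b ∈ B, (A.card : ℝ) ^ 2 / (2 * K ^ 2) ≤ S b := by
    apply exists_le_of_sum_le hB
    rw [sum_const, nsmul_eq_mul]
    calc (B.card : ℝ) * ((A.card : ℝ) ^ 2 / (2 * K ^ 2))
        = (A.card : ℝ) ^ 2 * B.card / (2 * K ^ 2) := by ring
      _ ≤ _ := h2
  -- Step 4: read off the two properties of `A' := N(b)`.
  have hcnt : ∀ a, ((({x ∈ A | (x, b) ∈ G}).filter fun a' =>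
      (#{y ∈ B | (a, y) ∈ G ∧ (a', y) ∈ G} : ℝ) < τ).card : ℝ)
        = ∑ a' ∈ {x ∈ A | (x, b) ∈ G},
          (if (#{y ∈ B | (a, y) ∈ G ∧ (a', y) ∈ G} : ℝ) < τ then (1 : ℝ) else 0) := by
    intro a
    rw [card_filter]
    push_cast
    rfl
  have hSb' : S b = (#{x ∈ A | (x, b) ∈ G} : ℝ) ^ 2 - ε⁻¹ * ∑ a ∈ {x ∈ A | (x, b) ∈ G},
      (#{a' ∈ {x ∈ A | (x, b) ∈ G} | (#{y ∈ B | (a, y) ∈ G ∧ (a', y) ∈ G} : ℝ) < τ} : ℝ) := by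
    simp only [hS, hw, sum_sub_distrib, sum_const, nsmul_eq_mul, ← mul_sum, hcnt]
    ring
  have hrest : 0 ≤ ε⁻¹ * ∑ a ∈ {x ∈ A | (x, b) ∈ G},
      (#{a' ∈ {x ∈ A | (x, b) ∈ G} | (#{y ∈ B | (a, y) ∈ G ∧ (a', y) ∈ G} : ℝ) < τ} : ℝ) :=
    mul_nonneg hεi.le (sum_nonneg fun _ _ => Nat.cast_nonneg _)
  refine ⟨{x ∈ A | (x, b) ∈ G}, filter_subset _ _, ?_, ?_⟩
  · have hN2 : (A.card : ℝ) ^ 2 / (2 * K ^ 2) ≤ (#{x ∈ A | (x, b) ∈ G} : ℝ) ^ 2 := by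
      refine hSb.trans ?_
      rw [hSb']
      linarith
    have e : (A.card : ℝ) / (Real.sqrt 2 * K) = Real.sqrt ((A.card : ℝ) ^ 2 / (2 * K ^ 2)) := by
      rw [Real.sqrt_div' _ (by positivity), Real.sqrt_sq (by positivity),
        Real.sqrt_mul' _ (by positivity), Real.sqrt_sq hK.le]
    rw [e, Real.sqrt_le_left (by positivity)]
    exact hN2
  · have h0 : (0 : ℝ) ≤ S b := le_trans (by positivity) hSb
    rw [hSb'] at h0
    have key : ∀ {R N : ℝ}, 0 ≤ N ^ 2 - ε⁻¹ * R → R ≤ ε * N ^ 2 := fun {R N} h => by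
      have h3 : ε⁻¹ * R ≤ N ^ 2 := by linarith
      calc R = ε * (ε⁻¹ * R) := by rw [← mul_assoc, mul_inv_cancel₀ hε.ne', one_mul]
        _ ≤ ε * N ^ 2 := mul_le_mul_of_nonneg_left h3 hε.le
    exact key h0

/-- Step 0 of Corollary 6.20: prune the left vertices of degree `< |B|/(2K)`; at least half of the
edges survive. [cite: TaoVu2006, §6.4, proof of Corollary 6.20] -/
lemma prune (A : Finset α) (B : Finset β) (G : Finset (α × β)) {K : ℝ} (hK : 0 < K)
    (hG : G ⊆ A ×ˢ B) (hE : (A.card : ℝ) * B.card / K ≤ G.card) :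
    ∃ At ⊆ A, ∃ Gt ⊆ G, Gt ⊆ At ×ˢ B ∧
      (∀ a ∈ At, (B.card : ℝ) / (2 * K) ≤ #{y ∈ B | (a, y) ∈ G}) ∧
      (A.card : ℝ) * B.card / (2 * K) ≤ Gt.card := by
  obtain ⟨At, hAt⟩ : ∃ At : Finset α,
      At = A.filter fun a => (B.card : ℝ) / (2 * K) ≤ #{y ∈ B | (a, y) ∈ G} := ⟨_, rfl⟩
  obtain ⟨Gt, hGt⟩ : ∃ Gt : Finset (α × β), Gt = G.filter fun p => p.1 ∈ At := ⟨_, rfl⟩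
  obtain ⟨R, hR⟩ : ∃ R : Finset (α × β), R = G.filter fun p => p.1 ∉ At := ⟨_, rfl⟩
  have hAtA : At ⊆ A := by rw [hAt]; exact filter_subset _ _
  have hGtG : Gt ⊆ G := by rw [hGt]; exact filter_subset _ _
  refine ⟨At, hAtA, Gt, hGtG, ?_, ?_, ?_⟩
  · intro p hp
    rw [hGt, mem_filter] at hp
    exact mem_product.mpr ⟨hp.2, (mem_product.mp (hG hp.1)).2⟩
  · intro a ha
    rw [hAt, mem_filter] at ha
    exact ha.2
  · have hRsub : R ⊆ A ×ˢ B := by rw [hR]; exact (filter_subset _ _).trans hG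
    have hsplit : (Gt.card : ℝ) + R.card = G.card := by
      rw [hGt, hR]
      exact_mod_cast card_filter_add_card_filter_not _
    have hRle : (R.card : ℝ) ≤ A.card * (B.card / (2 * K)) := by
      rw [card_eq_sum_deg_left hRsub, ← nsmul_eq_mul, ← sum_const]
      refine sum_le_sum fun a ha => ?_
      by_cases haT : a ∈ At
      · have h0 : {y ∈ B | (a, y) ∈ R} = ∅ := by
          rw [filter_eq_empty_iff]
          intro b _ hb
          rw [hR, mem_filter] at hb
          exact hb.2 haT
        rw [h0, card_empty, Nat.cast_zero]
        positivity
      · have e : {y ∈ B | (a, y) ∈ R} = {y ∈ B | (a, y) ∈ G} := by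
          refine filter_congr fun b _ => ?_
          rw [hR, mem_filter]
          exact ⟨fun h => h.1, fun h => ⟨h, haT⟩⟩
        rw [e]
        have hlt : ¬ ((B.card : ℝ) / (2 * K) ≤ #{y ∈ B | (a, y) ∈ G}) := by
          intro h
          exact haT (by rw [hAt, mem_filter]; exact ⟨ha, h⟩)
        exact (not_le.mp hlt).le
    have e : (A.card : ℝ) * B.card / (2 * K)
        = A.card * B.card / K - A.card * (B.card / (2 * K)) := by ring
    linarith only [hsplit, hRle, hE, e]

omit [DecidableEq α] in
/-- Step 2 of Corollary 6.20: if the bad pairs number at most `|A₁|²/(16K)`, then at least half of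
the vertices of `A₁` lie in at most `|A₁|/(8K)` bad pairs.
[cite: TaoVu2006, §6.4, proof of Corollary 6.20] -/
lemma half_good (A₁ : Finset α) (bad : α → ℕ) {K : ℝ} (hK : 0 < K) (hA₁ : (0 : ℝ) < A₁.card)
    (h : ∑ a ∈ A₁, (bad a : ℝ) ≤ 1 / (16 * K) * (A₁.card : ℝ) ^ 2) :
    (A₁.card : ℝ) / 2 ≤ (A₁.filter fun a => (bad a : ℝ) ≤ A₁.card / (8 * K)).card := by
  obtain ⟨C, hC⟩ : ∃ C : Finset α,
      C = A₁.filter fun a => ¬ ((bad a : ℝ) ≤ A₁.card / (8 * K)) := ⟨_, rfl⟩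
  have hsplit : ((A₁.filter fun a => (bad a : ℝ) ≤ A₁.card / (8 * K)).card : ℝ) + C.card
      = A₁.card := by
    rw [hC]
    exact_mod_cast card_filter_add_card_filter_not _
  have hC1 : (C.card : ℝ) * (A₁.card / (8 * K)) ≤ ∑ a ∈ C, (bad a : ℝ) := by
    rw [← nsmul_eq_mul, ← sum_const]
    refine sum_le_sum fun a ha => ?_
    rw [hC, mem_filter] at ha
    exact (not_le.mp ha.2).le
  have hC2 : ∑ a ∈ C, (bad a : ℝ) ≤ ∑ a ∈ A₁, (bad a : ℝ) := by
    refine sum_le_sum_of_subset_of_nonneg ?_ fun _ _ _ => Nat.cast_nonneg _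
    rw [hC]
    exact filter_subset _ _
  have hC3 := hC1.trans (hC2.trans h)
  have hC4 : (C.card : ℝ) * A₁.card ≤ A₁.card / 2 * A₁.card := by
    have h' := mul_le_mul_of_nonneg_right hC3 (show (0 : ℝ) ≤ 8 * K by positivity)
    have e1 : (C.card : ℝ) * (A₁.card / (8 * K)) * (8 * K) = C.card * A₁.card := by
      field_simp
    have e2 : 1 / (16 * K) * (A₁.card : ℝ) ^ 2 * (8 * K) = A₁.card / 2 * A₁.card := by
      field_simp
      ring
    rw [e1, e2] at h'
    exact h'
  have hC5 : (C.card : ℝ) ≤ A₁.card / 2 := le_of_mul_le_mul_right hC4 hA₁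
  linarith only [hsplit, hC5]

/-- Step 3 of Corollary 6.20: if every vertex of `A₁` has degree `≥ |B|/(2K)`, then at least
`|B|/(4K)` right vertices have `≥ |A₁|/(4K)` neighbours in `A₁`.
[cite: TaoVu2006, §6.4, proof of Corollary 6.20] -/
lemma popular (A₁ : Finset α) (B : Finset β) (G : Finset (α × β)) {K : ℝ} (hK : 0 < K)
    (hA₁ : (0 : ℝ) < A₁.card) (hdeg : ∀ a ∈ A₁, (B.card : ℝ) / (2 * K) ≤ #{y ∈ B | (a, y) ∈ G}) :
    (B.card : ℝ) / (4 * K)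
      ≤ (B.filter fun b => (A₁.card : ℝ) / (4 * K) ≤ #{x ∈ A₁ | (x, b) ∈ G}).card := by
  obtain ⟨B', hB'⟩ : ∃ B' : Finset β,
      B' = B.filter fun b => (A₁.card : ℝ) / (4 * K) ≤ #{x ∈ A₁ | (x, b) ∈ G} := ⟨_, rfl⟩
  obtain ⟨D, hD⟩ : ∃ D : Finset β,
      D = B.filter fun b => ¬ ((A₁.card : ℝ) / (4 * K) ≤ #{x ∈ A₁ | (x, b) ∈ G}) := ⟨_, rfl⟩
  rw [← hB']
  have hdeg_sum :
      ∑ b ∈ B, (#{x ∈ A₁ | (x, b) ∈ G} : ℝ) = ∑ a ∈ A₁, (#{y ∈ B | (a, y) ∈ G} : ℝ) := by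
    simp only [card_filter]
    push_cast
    exact sum_comm
  have hdeg_lb : (A₁.card : ℝ) * B.card / (2 * K) ≤ ∑ b ∈ B, (#{x ∈ A₁ | (x, b) ∈ G} : ℝ) := by
    rw [hdeg_sum]
    calc (A₁.card : ℝ) * B.card / (2 * K) = ∑ _a ∈ A₁, (B.card : ℝ) / (2 * K) := by
          rw [sum_const, nsmul_eq_mul]
          ring
      _ ≤ _ := sum_le_sum hdeg
  have hsumsplit : ∑ b ∈ B, (#{x ∈ A₁ | (x, b) ∈ G} : ℝ)
      = ∑ b ∈ B', (#{x ∈ A₁ | (x, b) ∈ G} : ℝ) + ∑ b ∈ D, (#{x ∈ A₁ | (x, b) ∈ G} : ℝ) := by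
    rw [hB', hD]
    exact (sum_filter_add_sum_filter_not B _ _).symm
  have h1 : ∑ b ∈ B', (#{x ∈ A₁ | (x, b) ∈ G} : ℝ) ≤ B'.card * A₁.card := by
    rw [← nsmul_eq_mul, ← sum_const]
    refine sum_le_sum fun b _ => ?_
    exact_mod_cast card_le_card (filter_subset _ _)
  have h2 : ∑ b ∈ D, (#{x ∈ A₁ | (x, b) ∈ G} : ℝ) ≤ D.card * (A₁.card / (4 * K)) := by
    rw [← nsmul_eq_mul, ← sum_const]
    refine sum_le_sum fun b hb => ?_
    rw [hD, mem_filter] at hb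
    exact (not_le.mp hb.2).le
  have hDB : (D.card : ℝ) ≤ B.card := by
    rw [hD]
    exact_mod_cast card_le_card (filter_subset _ _)
  have hA₁' : (0 : ℝ) ≤ A₁.card / (4 * K) := by positivity
  have h3 : (A₁.card : ℝ) * B.card / (2 * K)
      ≤ B'.card * A₁.card + B.card * (A₁.card / (4 * K)) := by
    calc (A₁.card : ℝ) * B.card / (2 * K) ≤ _ := hdeg_lb
      _ = _ := hsumsplit
      _ ≤ B'.card * A₁.card + D.card * (A₁.card / (4 * K)) := add_le_add h1 h2
      _ ≤ B'.card * A₁.card + B.card * (A₁.card / (4 * K)) := by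
          have := mul_le_mul_of_nonneg_right hDB hA₁'
          linarith only [this]
  have h4 : (B.card : ℝ) / (4 * K) * A₁.card ≤ B'.card * A₁.card := by
    have e : (A₁.card : ℝ) * B.card / (2 * K) - B.card * (A₁.card / (4 * K))
        = B.card / (4 * K) * A₁.card := by ring
    linarith only [h3, e]
  exact le_of_mul_le_mul_right h4 hA₁

/-- Step 4 of Corollary 6.20: a vertex `a` in few bad pairs and a popular vertex `b` are joined by
many paths of length three. [cite: TaoVu2006, §6.4, proof of Corollary 6.20] -/
lemma count_paths (A A₁ : Finset α) (B : Finset β) (G Gt : Finset (α × β)) (hGtG : Gt ⊆ G)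
    (hA₁A : A₁ ⊆ A) {K τ : ℝ} (hτ : 0 ≤ τ) (a : α) (b : β)
    (ha : (#{a' ∈ A₁ | (#{y ∈ B | (a, y) ∈ Gt ∧ (a', y) ∈ Gt} : ℝ) < τ} : ℝ) ≤ A₁.card / (8 * K))
    (hb : (A₁.card : ℝ) / (4 * K) ≤ #{x ∈ A₁ | (x, b) ∈ G}) :
    (A₁.card : ℝ) / (8 * K) * τ ≤ #{q ∈ A ×ˢ B | (a, q.2) ∈ G ∧ (q.1, q.2) ∈ G ∧ (q.1, b) ∈ G} := by
  obtain ⟨T, hT⟩ : ∃ T : Finset α, T = A₁.filter fun a' =>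
      (a', b) ∈ G ∧ ¬ ((#{y ∈ B | (a, y) ∈ Gt ∧ (a', y) ∈ Gt} : ℝ) < τ) := ⟨_, rfl⟩
  have hTA : T ⊆ A := by rw [hT]; exact (filter_subset _ _).trans hA₁A
  have hTb : ∀ a' ∈ T, (a', b) ∈ G := fun a' h => by
    rw [hT, mem_filter] at h
    exact h.2.1
  have hTcard : (A₁.card : ℝ) / (8 * K) ≤ T.card := by
    have hsub : {x ∈ A₁ | (x, b) ∈ G}
        ⊆ T ∪ {a' ∈ A₁ | (#{y ∈ B | (a, y) ∈ Gt ∧ (a', y) ∈ Gt} : ℝ) < τ} := by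
      intro a' ha'
      rw [mem_filter] at ha'
      rw [mem_union, hT, mem_filter, mem_filter]
      by_cases h : (#{y ∈ B | (a, y) ∈ Gt ∧ (a', y) ∈ Gt} : ℝ) < τ
      · exact Or.inr ⟨ha'.1, h⟩
      · exact Or.inl ⟨ha'.1, ha'.2, h⟩
    have h1 : (#{x ∈ A₁ | (x, b) ∈ G} : ℝ)
        ≤ T.card + (#{a' ∈ A₁ | (#{y ∈ B | (a, y) ∈ Gt ∧ (a', y) ∈ Gt} : ℝ) < τ} : ℝ) := by
      exact_mod_cast (card_le_card hsub).trans (card_union_le _ _)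
    have e : (A₁.card : ℝ) / (8 * K) = A₁.card / (4 * K) - A₁.card / (8 * K) := by ring
    linarith only [h1, ha, hb, e]
  have hp1 : (T.card : ℝ) * τ ≤ ∑ a' ∈ T, (#{y ∈ B | (a, y) ∈ Gt ∧ (a', y) ∈ Gt} : ℝ) := by
    rw [← nsmul_eq_mul, ← sum_const]
    refine sum_le_sum fun a' h => ?_
    rw [hT, mem_filter] at h
    exact not_lt.mp h.2.2
  have hp2 : ∑ a' ∈ T, (#{y ∈ B | (a, y) ∈ Gt ∧ (a', y) ∈ Gt} : ℝ)
      ≤ ∑ a' ∈ T, (#{y ∈ B | (a, y) ∈ G ∧ (a', y) ∈ G} : ℝ) := by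
    refine sum_le_sum fun a' _ => ?_
    exact_mod_cast paths₂_mono B hGtG a a'
  have hp3 : ∑ a' ∈ T, (#{y ∈ B | (a, y) ∈ G ∧ (a', y) ∈ G} : ℝ)
      ≤ #{q ∈ A ×ˢ B | (a, q.2) ∈ G ∧ (q.1, q.2) ∈ G ∧ (q.1, b) ∈ G} := by
    exact_mod_cast sum_paths₂_le_paths₃ hTA hTb
  have hp0 : (A₁.card : ℝ) / (8 * K) * τ ≤ T.card * τ := mul_le_mul_of_nonneg_right hTcard hτ
  linarith only [hp0, hp1, hp2, hp3]

/-- Arithmetic for Step 1 of Corollary 6.20: with `K̃ = 2K|Ã|/|A|` and `ε = 1/(16K)` the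
threshold `ε|B|/(2K̃²) = L²|B|/(128K³)` is at least `|B|/(128K³)`.
[cite: TaoVu2006, §6.4, proof of Corollary 6.20] -/
lemma threshold_le {A At B K : ℝ} (hK : 0 < K) (hA : 0 < A) (hAt : 0 < At) (hB : 0 ≤ B)
    (hle : At ≤ A) :
    B / (128 * K ^ 3) ≤ 1 / (16 * K) * B / (2 * (2 * K * At / A) ^ 2) := by
  have e : 1 / (16 * K) * B / (2 * (2 * K * At / A) ^ 2)
      = B / (128 * K ^ 3) * (A / At) ^ 2 := by
    field_simp
    ring
  rw [e]
  have h1 : (1 : ℝ) ≤ A / At := by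
    rw [le_div_iff₀ hAt, one_mul]
    exact hle
  have h2 : (1 : ℝ) ≤ (A / At) ^ 2 := one_le_pow₀ h1
  have h0 : 0 ≤ B / (128 * K ^ 3) := by positivity
  calc B / (128 * K ^ 3) = B / (128 * K ^ 3) * 1 := (mul_one _).symm
    _ ≤ _ := mul_le_mul_of_nonneg_left h2 h0

/-- Arithmetic for the final count of Corollary 6.20: `16√2 · 128 = 2¹¹√2 ≤ 2¹²`.
[cite: TaoVu2006, §6.4, proof of Corollary 6.20] -/
lemma const_bound {a b K : ℝ} (hK : 0 < K) (ha : 0 ≤ a) (hb : 0 ≤ b) :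
    a * b / (2 ^ 12 * K ^ 5) ≤ a / (2 * Real.sqrt 2 * K) / (8 * K) * (b / (128 * K ^ 3)) := by
  have hc : (0 : ℝ) < 2048 * Real.sqrt 2 * K ^ 5 := by positivity
  have hcb : 2048 * Real.sqrt 2 * K ^ 5 ≤ 2 ^ 12 * K ^ 5 := by
    have hs2 : Real.sqrt 2 ≤ 2 := by
      rw [Real.sqrt_le_left (by norm_num)]
      norm_num
    have h5 := mul_le_mul_of_nonneg_right hs2 (pow_pos hK 5).le
    linarith only [h5]
  calc a * b / (2 ^ 12 * K ^ 5) ≤ a * b / (2048 * Real.sqrt 2 * K ^ 5) :=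
        div_le_div_of_nonneg_left (mul_nonneg ha hb) hc hcb
    _ = a / (2 * Real.sqrt 2 * K) / (8 * K) * (b / (128 * K ^ 3)) := by
        field_simp
        ring

/-- **Paths of length three** (Tao–Vu, Corollary 6.20): if `G ⊆ A ×ˢ B` has at least `|A||B|/K`
edges (`K ≥ 1`) then there are `A' ⊆ A`, `B' ⊆ B` with `|A'| ≥ |A|/(4√2 K)`, `|B'| ≥ |B|/(4K)` such
that every `a ∈ A'`, `b ∈ B'` are joined by at least `|A||B|/(2¹² K⁵)` paths of length three.
[cite: TaoVu2006, Corollary 6.20] -/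
lemma paths_three (A : Finset α) (B : Finset β) (G : Finset (α × β)) {K : ℝ} (hK : 1 ≤ K)
    (hG : G ⊆ A ×ˢ B) (hA : A.Nonempty) (hB : B.Nonempty)
    (hE : (A.card : ℝ) * B.card / K ≤ G.card) :
    ∃ A' ⊆ A, ∃ B' ⊆ B, (A.card : ℝ) / (4 * Real.sqrt 2 * K) ≤ A'.card ∧
      (B.card : ℝ) / (4 * K) ≤ B'.card ∧
      ∀ a ∈ A', ∀ b ∈ B', (A.card : ℝ) * B.card / (2 ^ 12 * K ^ 5)
        ≤ #{q ∈ A ×ˢ B | (a, q.2) ∈ G ∧ (q.1, q.2) ∈ G ∧ (q.1, b) ∈ G} := by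
  have hK0 : 0 < K := lt_of_lt_of_le one_pos hK
  have hApos : (0 : ℝ) < A.card := by exact_mod_cast hA.card_pos
  have hBpos : (0 : ℝ) < B.card := by exact_mod_cast hB.card_pos
  -- Step 0: prune the low-degree left vertices.
  obtain ⟨At, hAtA, Gt, hGtG, hGt_sub, hdegAt, hGt_card⟩ := prune A B G hK0 hG hE
  have hAt_ne : At.Nonempty := by
    have hGt_pos : (0 : ℝ) < Gt.card := lt_of_lt_of_le (by positivity) hGt_card
    have hne : Gt.Nonempty := by
      rw [← card_pos]
      exact_mod_cast hGt_pos
    obtain ⟨p, hp⟩ := hne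
    exact ⟨p.1, (mem_product.mp (hGt_sub hp)).1⟩
  have hAtpos : (0 : ℝ) < At.card := by exact_mod_cast hAt_ne.card_pos
  have hAtA' : (At.card : ℝ) ≤ A.card := by exact_mod_cast card_le_card hAtA
  -- Step 1: Lemma 6.19 in the pruned graph, with `K̃ = 2K|Ã|/|A|`, `ε = 1/(16K)` and threshold
  -- `|B|/(128K³)`.
  have hKt0 : (0 : ℝ) < 2 * K * At.card / A.card := by positivity
  have hε0 : (0 : ℝ) < 1 / (16 * K) := by positivity
  have hτ0 : (0 : ℝ) ≤ B.card / (128 * K ^ 3) := by positivity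
  have hτle := threshold_le hK0 hApos hAtpos hBpos.le hAtA'
  have hEt : (At.card : ℝ) * B.card / (2 * K * At.card / A.card) ≤ Gt.card := by
    have e : (At.card : ℝ) * B.card / (2 * K * At.card / A.card)
        = A.card * B.card / (2 * K) := by
      field_simp
    rw [e]
    exact hGt_card
  obtain ⟨A₁, hA₁At, hA₁card, hA₁bad⟩ :=
    paths_two At B Gt hKt0 hε0 hτ0 hτle hGt_sub hB hEt
  have hA₁card' : (A.card : ℝ) / (2 * Real.sqrt 2 * K) ≤ A₁.card := by
    have e : (At.card : ℝ) / (Real.sqrt 2 * (2 * K * At.card / A.card))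
        = A.card / (2 * Real.sqrt 2 * K) := by
      field_simp
    rw [← e]
    exact hA₁card
  have hA₁pos : (0 : ℝ) < A₁.card := lt_of_lt_of_le (by positivity) hA₁card'
  have hA₁A : A₁ ⊆ A := hA₁At.trans hAtA
  -- Steps 2–3: the sets `A'` and `B'`.
  obtain ⟨bad, hbad⟩ : ∃ bad : α → ℕ, ∀ a,
      bad a = #{a' ∈ A₁ | (#{y ∈ B | (a, y) ∈ Gt ∧ (a', y) ∈ Gt} : ℝ) < B.card / (128 * K ^ 3)} :=
    ⟨_, fun _ => rfl⟩
  simp only [← hbad] at hA₁bad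
  have hA' := half_good A₁ bad hK0 hA₁pos hA₁bad
  have hB' := popular A₁ B G hK0 hA₁pos fun a ha => hdegAt a (hA₁At ha)
  refine ⟨A₁.filter fun a => (bad a : ℝ) ≤ A₁.card / (8 * K), (filter_subset _ _).trans hA₁A,
    B.filter fun b => (A₁.card : ℝ) / (4 * K) ≤ #{x ∈ A₁ | (x, b) ∈ G}, filter_subset _ _,
    ?_, hB', ?_⟩
  · have e : (A.card : ℝ) / (4 * Real.sqrt 2 * K) = A.card / (2 * Real.sqrt 2 * K) / 2 := by
      ring
    rw [e]
    linarith only [hA', hA₁card']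
  -- Step 4: count the paths of length three.
  · intro a ha b hb
    rw [mem_filter] at ha hb
    have ha' := ha.2
    rw [hbad] at ha'
    have hcount := count_paths A A₁ B G Gt hGtG hA₁A hτ0 a b ha' hb.2
    have hconst := const_bound hK0 hApos.le hBpos.le
      (a := (A.card : ℝ)) (b := (B.card : ℝ)) (K := K)
    have hmid : (A.card : ℝ) / (2 * Real.sqrt 2 * K) / (8 * K) * (B.card / (128 * K ^ 3))
        ≤ A₁.card / (8 * K) * (B.card / (128 * K ^ 3)) := by
      have h8 : (A.card : ℝ) / (2 * Real.sqrt 2 * K) / (8 * K) ≤ A₁.card / (8 * K) :=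
        div_le_div_of_nonneg_right hA₁card' (by positivity)
      exact mul_le_mul_of_nonneg_right h8 hτ0
    linarith only [hcount, hconst, hmid]

end BalogSzemerediGowersProof

open BalogSzemerediGowersProof in
/-- **Proof of Theorem 2.29** (Tao–Vu, §6.4): Corollary 6.20 applied to the graph `G`, then the
identity `a + b = (a + b') - (a' + b') + (a' + b)` turns each path of length three `a — b' — a' — b`
into a distinct triple `(x, y, z) ∈ (A +_G B)³` with `x - y + z = a + b`; the fibres over distinct
sums are disjoint, so `|A' + B'| · |A||B|/(2¹²K⁵) ≤ |A +_G B|³ ≤ (K')³ (|A||B|)^{3/2}`.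
[cite: TaoVu2006, Theorem 2.29 and §6.4 (Lemma 6.19, Corollary 6.20)] -/
theorem balogSzemerediGowers_holds : balogSzemerediGowers := by
  intro Z _ _ A B G K K' hA hB hK hK' hG hE hS
  obtain ⟨A', hA'A, B', hB'B, hA'card, hB'card, hpaths⟩ := paths_three A B G hK hG hA hB hE
  refine ⟨A', hA'A, B', hB'B, hA'card, hB'card, ?_⟩
  have hK0 : 0 < K := lt_of_lt_of_le one_pos hK
  have hApos : (0 : ℝ) < A.card := by exact_mod_cast hA.card_pos
  have hBpos : (0 : ℝ) < B.card := by exact_mod_cast hB.card_pos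
  obtain ⟨S, hSdef⟩ : ∃ S : Finset Z, S = partialSumset G := ⟨_, rfl⟩
  rw [← hSdef] at hS
  obtain ⟨N, hN⟩ : ∃ N : ℝ, N = (A.card : ℝ) * B.card / (2 ^ 12 * K ^ 5) := ⟨_, rfl⟩
  simp only [← hN] at hpaths
  have hNpos : 0 < N := by rw [hN]; positivity
  -- the fibre map `(x, y, z) ↦ x - y + z`
  obtain ⟨φ, hφ⟩ : ∃ φ : Z × (Z × Z) → Z, ∀ t, φ t = t.1 - t.2.1 + t.2.2 := ⟨_, fun _ => rfl⟩
  -- each fibre over `A' + B'` contains at least `N` triples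
  have hfib : ∀ s ∈ A' + B', N ≤ (((S ×ˢ (S ×ˢ S)).filter fun t => φ t = s).card : ℝ) := by
    intro s hs
    rw [Finset.mem_add] at hs
    obtain ⟨a, ha, b, hb, rfl⟩ := hs
    refine (hpaths a ha b hb).trans ?_
    have hinj : #{q ∈ A ×ˢ B | (a, q.2) ∈ G ∧ (q.1, q.2) ∈ G ∧ (q.1, b) ∈ G}
        ≤ #{t ∈ S ×ˢ (S ×ˢ S) | φ t = a + b} := by
      apply card_le_card_of_injOn (fun q => (a + q.2, (q.1 + q.2, q.1 + b)))
      · intro q hq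
        rw [mem_coe, mem_filter] at hq
        obtain ⟨-, h1, h2, h3⟩ := hq
        rw [mem_coe, mem_filter, mem_product, mem_product, hφ, hSdef]
        refine ⟨⟨?_, ?_, ?_⟩, ?_⟩
        · exact mem_image_of_mem (fun p : Z × Z => p.1 + p.2) h1
        · exact mem_image_of_mem (fun p : Z × Z => p.1 + p.2) h2
        · exact mem_image_of_mem (fun p : Z × Z => p.1 + p.2) h3
        · show a + q.2 - (q.1 + q.2) + (q.1 + b) = a + b
          abel
      · intro q₁ _ q₂ _ h
        simp only [Prod.mk.injEq] at h
        obtain ⟨h1, -, h3⟩ := h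
        exact Prod.ext (add_right_cancel h3) (add_left_cancel h1)
    exact_mod_cast hinj
  -- the fibres are disjoint, so `|A' + B'| N ≤ |S|³`
  have hkey : ((A' + B').card : ℝ) * N ≤ (S.card : ℝ) ^ 3 := by
    have hsum := sum_card_fiberwise_eq_card_filter (S ×ˢ (S ×ˢ S)) (A' + B') φ
    have hle : ((S ×ˢ (S ×ˢ S)).filter fun t => φ t ∈ A' + B').card ≤ S.card ^ 3 := by
      calc _ ≤ (S ×ˢ (S ×ˢ S)).card := card_filter_le _ _
        _ = S.card ^ 3 := by rw [card_product, card_product]; ring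
    calc ((A' + B').card : ℝ) * N = ∑ _s ∈ A' + B', N := by rw [sum_const, nsmul_eq_mul]
      _ ≤ ∑ s ∈ A' + B', (((S ×ˢ (S ×ˢ S)).filter fun t => φ t = s).card : ℝ) :=
          sum_le_sum hfib
      _ = ((((S ×ˢ (S ×ˢ S)).filter fun t => φ t ∈ A' + B').card : ℕ) : ℝ) := by
          rw [← hsum]
          push_cast
          rfl
      _ ≤ (S.card : ℝ) ^ 3 := by exact_mod_cast hle
  -- conclude
  have hS3 : (S.card : ℝ) ^ 3 ≤ (K' * Real.sqrt (A.card * B.card)) ^ 3 :=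
    pow_le_pow_left₀ (Nat.cast_nonneg _) hS 3
  have hsq : Real.sqrt ((A.card : ℝ) * B.card) ^ 2 = A.card * B.card :=
    Real.sq_sqrt (by positivity)
  have e : (K' * Real.sqrt (A.card * B.card)) ^ 3 / N
      = 2 ^ 12 * K ^ 5 * K' ^ 3 * Real.sqrt (A.card * B.card) := by
    rw [hN, mul_pow, pow_succ (Real.sqrt _) 2, hsq]
    field_simp
  calc ((A' + B').card : ℝ) ≤ (S.card : ℝ) ^ 3 / N := by
        rw [le_div_iff₀ hNpos]
        exact hkey
    _ ≤ (K' * Real.sqrt (A.card * B.card)) ^ 3 / N :=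
        div_le_div_of_nonneg_right hS3 hNpos.le
    _ = _ := e

end Literature.Combinatorics.Additive
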